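import Mathlib
import Summits.HodgeConjecture.HodgeConjecture.Theorems.TropicalKugaSatakeCayleyCayleyHodgeRankTwoCuspForms
import Summits.HodgeConjecture.HodgeConjecture.Theorems.TropicalKugaSatakeCayleyCayleyHodgeRankTwoCuspMatrices
import Summits.HodgeConjecture.HodgeConjecture.Theorems.TropicalKugaSatakeCayleyCayleyHodgeRankTwoSlotLeibniz
import Summits.HodgeConjecture.HodgeConjecture.Theorems.TropicalKugaSatakeCayleyCayleyHodgeRankTwoFlatCertificate
import Summits.HodgeConjecture.HodgeConjecture.Theorems.TropicalKugaSatakeCayleyCayleyHodgeRankTwoLefschetzTransfer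

/-!
# Route `TropicalKugaSatakeCayley`, support S5 `CayleyHodgeRankTwo` (stmt-HodgeConjecture-18573) — part B8b:
# kernel-checked flatness certificates — the `θ²`-table along the five scaled lowering operators

For each listed cusp operator `N` (part B6) and the table `κ` (part B3) this file proves
`∀ u, Σₘ κ(u₀, …, N uₘ, …, u₃) = 0` — the slotwise derivation of `κ` along `N` vanishes identically —
by the pipeline of parts B4–B6: `tkc_slotSum_table_cols` expands the derivation into the explicit integral
combination `Σ_{t,j,s} (coef t · val_s) • θ_{word t [j ↦ col_s]}` of monomials of modified words, and
`tkc_cert_sum_eq_zero` kills it given a CERTIFICATE (reference words `Ω`, tags `none | some (group,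
adjacent swaps)`) whose three finite hypotheses are checked by `decide` in the kernel. The certificates
were produced by exact integer linear algebra (the common kernel of the ten derivations on `Λ^{2,2}`
has dimension `6 = 1 + 5`, van Geemen–Verra Cor. 6.5) and are merely verified here. Theorems only:
no definition, no named fact, no sorry; `decide` uses kernel reduction only (no `native_decide`).

## References

* [vanGeemenVerra2003QuaternionicPryms] B. van Geemen, A. Verra, Quaternionic Pryms and Hodge classes,
  Topology 42 (2003), §6.1, Cor. 6.5, Lemma 6.8.
-/

noncomputable section

set_option linter.dupNamespace false

namespace Summit.HodgeConjecture.HodgeConjecture.Theorems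

open Literature.LinearAlgebra.Alternating

/-- **The `θ²`-table `tkcTheta22` is flat along the scaled lowering operator `s_0 N'_0 = tkcLower (tkcLowerInt 0)`** (certificate: 0 reference words,
0 live terms; kernel-checked). [cite: vanGeemenVerra2003QuaternionicPryms, Cor. 6.5] -/
theorem tkc_flat_theta_lowerInt_0 (u : Fin 4 → (Fin 8 ⊕ Fin 8 → ℝ)) :
    ∑ m, tkcTheta22 (Function.update u m (tkcLower ((tkcLowerInt 0).map (Int.cast : ℤ → ℝ)) (u m))) = 0 := by
  rw [tkcTheta22_eq, tkcTable_eq,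
    tkc_slotSum_table_cols tkcFrame tkcVec tkc_sum_smulRight_frame_vec (tkcLower ((tkcLowerInt 0).map (Int.cast : ℤ → ℝ)))
      tkcThetaWord (fun _ => 1) (tkcLowerCol 0) (tkcLowerVal 0) (tkc_lowerInt_frame_vec_eq 0) u]
  refine tkc_apply_eq_zero_of_eq_zero ?_ u
  exact tkc_cert_sum_eq_zero (fun a => (tkcFrame a).smulRight (1 : ℂ))
    (ContinuousAlternatingMap.constOfIsEmpty ℝ (Fin 8 ⊕ Fin 8 → ℝ) (Fin 0) (1 : ℂ))
    (fun t j s => (fun _ : Fin 28 => (1 : ℤ)) t * tkcLowerVal 0 s (tkcThetaWord t j))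
    (fun t j s => Function.update (tkcThetaWord t) j (tkcLowerCol 0 s (tkcThetaWord t j)))
    ((![]) : Fin 0 → (Fin 4 → Fin 16))
    ((fun _ _ _ => none) : Fin 28 → Fin 4 → Fin 2 → Option (Fin 0 × List (Fin 3)))
    (by decide +kernel) (by decide +kernel) (by decide +kernel)

/-- **The `θ²`-table `tkcTheta22` is flat along the scaled lowering operator `s_1 N'_1 = tkcLower (tkcLowerInt 1)`** (certificate: 0 reference words,
0 live terms; kernel-checked). [cite: vanGeemenVerra2003QuaternionicPryms, Cor. 6.5] -/
theorem tkc_flat_theta_lowerInt_1 (u : Fin 4 → (Fin 8 ⊕ Fin 8 → ℝ)) :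
    ∑ m, tkcTheta22 (Function.update u m (tkcLower ((tkcLowerInt 1).map (Int.cast : ℤ → ℝ)) (u m))) = 0 := by
  rw [tkcTheta22_eq, tkcTable_eq,
    tkc_slotSum_table_cols tkcFrame tkcVec tkc_sum_smulRight_frame_vec (tkcLower ((tkcLowerInt 1).map (Int.cast : ℤ → ℝ)))
      tkcThetaWord (fun _ => 1) (tkcLowerCol 1) (tkcLowerVal 1) (tkc_lowerInt_frame_vec_eq 1) u]
  refine tkc_apply_eq_zero_of_eq_zero ?_ u
  exact tkc_cert_sum_eq_zero (fun a => (tkcFrame a).smulRight (1 : ℂ))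
    (ContinuousAlternatingMap.constOfIsEmpty ℝ (Fin 8 ⊕ Fin 8 → ℝ) (Fin 0) (1 : ℂ))
    (fun t j s => (fun _ : Fin 28 => (1 : ℤ)) t * tkcLowerVal 1 s (tkcThetaWord t j))
    (fun t j s => Function.update (tkcThetaWord t) j (tkcLowerCol 1 s (tkcThetaWord t j)))
    ((![]) : Fin 0 → (Fin 4 → Fin 16))
    ((fun _ _ _ => none) : Fin 28 → Fin 4 → Fin 2 → Option (Fin 0 × List (Fin 3)))
    (by decide +kernel) (by decide +kernel) (by decide +kernel)

/-- **The `θ²`-table `tkcTheta22` is flat along the scaled lowering operator `s_2 N'_2 = tkcLower (tkcLowerInt 2)`** (certificate: 24 reference words,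
48 live terms; kernel-checked). [cite: vanGeemenVerra2003QuaternionicPryms, Cor. 6.5] -/
theorem tkc_flat_theta_lowerInt_2 (u : Fin 4 → (Fin 8 ⊕ Fin 8 → ℝ)) :
    ∑ m, tkcTheta22 (Function.update u m (tkcLower ((tkcLowerInt 2).map (Int.cast : ℤ → ℝ)) (u m))) = 0 := by
  rw [tkcTheta22_eq, tkcTable_eq,
    tkc_slotSum_table_cols tkcFrame tkcVec tkc_sum_smulRight_frame_vec (tkcLower ((tkcLowerInt 2).map (Int.cast : ℤ → ℝ)))
      tkcThetaWord (fun _ => 1) (tkcLowerCol 2) (tkcLowerVal 2) (tkc_lowerInt_frame_vec_eq 2) u]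
  refine tkc_apply_eq_zero_of_eq_zero ?_ u
  exact tkc_cert_sum_eq_zero (fun a => (tkcFrame a).smulRight (1 : ℂ))
    (ContinuousAlternatingMap.constOfIsEmpty ℝ (Fin 8 ⊕ Fin 8 → ℝ) (Fin 0) (1 : ℂ))
    (fun t j s => (fun _ : Fin 28 => (1 : ℤ)) t * tkcLowerVal 2 s (tkcThetaWord t j))
    (fun t j s => Function.update (tkcThetaWord t) j (tkcLowerCol 2 s (tkcThetaWord t j)))
    ((![
      ![0, 1, 2, 10], ![0, 2, 3, 8], ![0, 1, 3, 11], ![0, 1, 4, 12], ![0, 4, 5, 8], ![0, 1, 5, 13],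
      ![0, 1, 6, 14], ![0, 6, 7, 8], ![0, 1, 7, 15], ![1, 2, 3, 9], ![1, 4, 5, 9], ![1, 6, 7, 9],
      ![2, 3, 4, 12], ![2, 4, 5, 10], ![2, 3, 5, 13], ![2, 3, 6, 14], ![2, 6, 7, 10], ![2, 3, 7, 15],
      ![3, 4, 5, 11], ![3, 6, 7, 11], ![4, 5, 6, 14], ![4, 6, 7, 12], ![4, 5, 7, 15], ![5, 6, 7, 13]]) : Fin 24 → (Fin 4 → Fin 16))
    ((![
      ![![none, none], ![none, none], ![none, none], ![none, none]],
      ![![none, none], ![none, none], ![none, some (0, [1])], ![none, some (1, [2])]],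
      ![![none, none], ![none, none], ![none, some (2, [1])], ![some (1, [2, 1]), none]],
      ![![none, none], ![none, none], ![none, some (3, [1])], ![none, some (4, [2])]],
      ![![none, none], ![none, none], ![none, some (5, [1])], ![some (4, [2, 1]), none]],
      ![![none, none], ![none, none], ![none, some (6, [1])], ![none, some (7, [2])]],
      ![![none, none], ![none, none], ![none, some (8, [1])], ![some (7, [2, 1]), none]],
      ![![none, none], ![none, none], ![some (0, [1, 0]), none], ![none, some (9, [2])]],
      ![![none, none], ![none, none], ![some (2, [1, 0]), none], ![some (9, [2, 1]), none]],
      ![![none, none], ![none, none], ![some (3, [1, 0]), none], ![none, some (10, [2])]],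
      ![![none, none], ![none, none], ![some (5, [1, 0]), none], ![some (10, [2, 1]), none]],
      ![![none, none], ![none, none], ![some (6, [1, 0]), none], ![none, some (11, [2])]],
      ![![none, none], ![none, none], ![some (8, [1, 0]), none], ![some (11, [2, 1]), none]],
      ![![none, none], ![none, none], ![none, none], ![none, none]],
      ![![none, none], ![none, none], ![none, some (12, [1])], ![none, some (13, [2])]],
      ![![none, none], ![none, none], ![none, some (14, [1])], ![some (13, [2, 1]), none]],
      ![![none, none], ![none, none], ![none, some (15, [1])], ![none, some (16, [2])]],
      ![![none, none], ![none, none], ![none, some (17, [1])], ![some (16, [2, 1]), none]],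
      ![![none, none], ![none, none], ![some (12, [1, 0]), none], ![none, some (18, [2])]],
      ![![none, none], ![none, none], ![some (14, [1, 0]), none], ![some (18, [2, 1]), none]],
      ![![none, none], ![none, none], ![some (15, [1, 0]), none], ![none, some (19, [2])]],
      ![![none, none], ![none, none], ![some (17, [1, 0]), none], ![some (19, [2, 1]), none]],
      ![![none, none], ![none, none], ![none, none], ![none, none]],
      ![![none, none], ![none, none], ![none, some (20, [1])], ![none, some (21, [2])]],
      ![![none, none], ![none, none], ![none, some (22, [1])], ![some (21, [2, 1]), none]],
      ![![none, none], ![none, none], ![some (20, [1, 0]), none], ![none, some (23, [2])]],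
      ![![none, none], ![none, none], ![some (22, [1, 0]), none], ![some (23, [2, 1]), none]],
      ![![none, none], ![none, none], ![none, none], ![none, none]]]) : Fin 28 → Fin 4 → Fin 2 → Option (Fin 24 × List (Fin 3)))
    (by decide +kernel) (by decide +kernel) (by decide +kernel)

/-- **The `θ²`-table `tkcTheta22` is flat along the scaled lowering operator `s_3 N'_3 = tkcLower (tkcLowerInt 3)`** (certificate: 24 reference words,
48 live terms; kernel-checked). [cite: vanGeemenVerra2003QuaternionicPryms, Cor. 6.5] -/
theorem tkc_flat_theta_lowerInt_3 (u : Fin 4 → (Fin 8 ⊕ Fin 8 → ℝ)) :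
    ∑ m, tkcTheta22 (Function.update u m (tkcLower ((tkcLowerInt 3).map (Int.cast : ℤ → ℝ)) (u m))) = 0 := by
  rw [tkcTheta22_eq, tkcTable_eq,
    tkc_slotSum_table_cols tkcFrame tkcVec tkc_sum_smulRight_frame_vec (tkcLower ((tkcLowerInt 3).map (Int.cast : ℤ → ℝ)))
      tkcThetaWord (fun _ => 1) (tkcLowerCol 3) (tkcLowerVal 3) (tkc_lowerInt_frame_vec_eq 3) u]
  refine tkc_apply_eq_zero_of_eq_zero ?_ u
  exact tkc_cert_sum_eq_zero (fun a => (tkcFrame a).smulRight (1 : ℂ))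
    (ContinuousAlternatingMap.constOfIsEmpty ℝ (Fin 8 ⊕ Fin 8 → ℝ) (Fin 0) (1 : ℂ))
    (fun t j s => (fun _ : Fin 28 => (1 : ℤ)) t * tkcLowerVal 3 s (tkcThetaWord t j))
    (fun t j s => Function.update (tkcThetaWord t) j (tkcLowerCol 3 s (tkcThetaWord t j)))
    ((![
      ![0, 1, 2, 9], ![0, 1, 3, 8], ![0, 2, 3, 11], ![0, 2, 4, 12], ![0, 4, 6, 8], ![0, 2, 5, 13],
      ![0, 5, 7, 8], ![0, 2, 6, 14], ![0, 2, 7, 15], ![1, 2, 3, 10], ![1, 3, 4, 12], ![1, 4, 6, 9],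
      ![1, 3, 5, 13], ![1, 5, 7, 9], ![1, 3, 6, 14], ![1, 3, 7, 15], ![2, 4, 6, 10], ![2, 5, 7, 10],
      ![3, 4, 6, 11], ![3, 5, 7, 11], ![4, 5, 6, 13], ![4, 5, 7, 12], ![4, 6, 7, 15], ![5, 6, 7, 14]]) : Fin 24 → (Fin 4 → Fin 16))
    ((![
      ![![none, none], ![none, none], ![none, some (0, [])], ![none, some (1, [2])]],
      ![![none, none], ![none, none], ![none, none], ![none, none]],
      ![![none, none], ![none, none], ![none, some (2, [1])], ![some (1, [2, 1]), none]],
      ![![none, none], ![none, none], ![none, some (3, [1])], ![none, some (4, [2])]],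
      ![![none, none], ![none, none], ![none, some (5, [1])], ![none, some (6, [2])]],
      ![![none, none], ![none, none], ![none, some (7, [1])], ![some (4, [2, 1]), none]],
      ![![none, none], ![none, none], ![none, some (8, [1])], ![some (6, [2, 1]), none]],
      ![![none, none], ![none, none], ![none, some (9, [])], ![some (0, [2, 1, 0]), none]],
      ![![none, none], ![none, none], ![none, none], ![none, none]],
      ![![none, none], ![none, none], ![none, some (10, [1])], ![none, some (11, [2])]],
      ![![none, none], ![none, none], ![none, some (12, [1])], ![none, some (13, [2])]],
      ![![none, none], ![none, none], ![none, some (14, [1])], ![some (11, [2, 1]), none]],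
      ![![none, none], ![none, none], ![none, some (15, [1])], ![some (13, [2, 1]), none]],
      ![![none, none], ![none, none], ![some (2, [1, 0]), none], ![some (9, [2, 1, 0]), none]],
      ![![none, none], ![none, none], ![some (3, [1, 0]), none], ![none, some (16, [2])]],
      ![![none, none], ![none, none], ![some (5, [1, 0]), none], ![none, some (17, [2])]],
      ![![none, none], ![none, none], ![some (7, [1, 0]), none], ![some (16, [2, 1]), none]],
      ![![none, none], ![none, none], ![some (8, [1, 0]), none], ![some (17, [2, 1]), none]],
      ![![none, none], ![none, none], ![some (10, [1, 0]), none], ![none, some (18, [2])]],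
      ![![none, none], ![none, none], ![some (12, [1, 0]), none], ![none, some (19, [2])]],
      ![![none, none], ![none, none], ![some (14, [1, 0]), none], ![some (18, [2, 1]), none]],
      ![![none, none], ![none, none], ![some (15, [1, 0]), none], ![some (19, [2, 1]), none]],
      ![![none, none], ![none, none], ![none, some (20, [])], ![none, some (21, [2])]],
      ![![none, none], ![none, none], ![none, none], ![none, none]],
      ![![none, none], ![none, none], ![none, some (22, [1])], ![some (21, [2, 1]), none]],
      ![![none, none], ![none, none], ![none, some (23, [])], ![some (20, [2, 1, 0]), none]],
      ![![none, none], ![none, none], ![none, none], ![none, none]],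
      ![![none, none], ![none, none], ![some (22, [1, 0]), none], ![some (23, [2, 1, 0]), none]]]) : Fin 28 → Fin 4 → Fin 2 → Option (Fin 24 × List (Fin 3)))
    (by decide +kernel) (by decide +kernel) (by decide +kernel)

/-- **The `θ²`-table `tkcTheta22` is flat along the scaled lowering operator `s_4 N'_4 = tkcLower (tkcLowerInt 4)`** (certificate: 24 reference words,
48 live terms; kernel-checked). [cite: vanGeemenVerra2003QuaternionicPryms, Cor. 6.5] -/
theorem tkc_flat_theta_lowerInt_4 (u : Fin 4 → (Fin 8 ⊕ Fin 8 → ℝ)) :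
    ∑ m, tkcTheta22 (Function.update u m (tkcLower ((tkcLowerInt 4).map (Int.cast : ℤ → ℝ)) (u m))) = 0 := by
  rw [tkcTheta22_eq, tkcTable_eq,
    tkc_slotSum_table_cols tkcFrame tkcVec tkc_sum_smulRight_frame_vec (tkcLower ((tkcLowerInt 4).map (Int.cast : ℤ → ℝ)))
      tkcThetaWord (fun _ => 1) (tkcLowerCol 4) (tkcLowerVal 4) (tkc_lowerInt_frame_vec_eq 4) u]
  refine tkc_apply_eq_zero_of_eq_zero ?_ u
  exact tkc_cert_sum_eq_zero (fun a => (tkcFrame a).smulRight (1 : ℂ))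
    (ContinuousAlternatingMap.constOfIsEmpty ℝ (Fin 8 ⊕ Fin 8 → ℝ) (Fin 0) (1 : ℂ))
    (fun t j s => (fun _ : Fin 28 => (1 : ℤ)) t * tkcLowerVal 4 s (tkcThetaWord t j))
    (fun t j s => Function.update (tkcThetaWord t) j (tkcLowerCol 4 s (tkcThetaWord t j)))
    ((![
      ![0, 1, 4, 9], ![0, 1, 5, 8], ![0, 2, 4, 10], ![0, 2, 6, 8], ![0, 3, 4, 11], ![0, 3, 7, 8],
      ![0, 4, 5, 13], ![0, 4, 6, 14], ![0, 4, 7, 15], ![1, 2, 5, 10], ![1, 2, 6, 9], ![1, 3, 5, 11],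
      ![1, 3, 7, 9], ![1, 4, 5, 12], ![1, 5, 6, 14], ![1, 5, 7, 15], ![2, 3, 6, 11], ![2, 3, 7, 10],
      ![2, 4, 6, 12], ![2, 5, 6, 13], ![2, 6, 7, 15], ![3, 4, 7, 12], ![3, 5, 7, 13], ![3, 6, 7, 14]]) : Fin 24 → (Fin 4 → Fin 16))
    ((![
      ![![none, none], ![none, none], ![none, some (0, [])], ![none, some (1, [2])]],
      ![![none, none], ![none, none], ![none, some (2, [])], ![none, some (3, [2])]],
      ![![none, none], ![none, none], ![none, some (4, [])], ![none, some (5, [2])]],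
      ![![none, none], ![none, none], ![none, none], ![none, none]],
      ![![none, none], ![none, none], ![none, some (6, [1])], ![some (1, [2, 1]), none]],
      ![![none, none], ![none, none], ![none, some (7, [1])], ![some (3, [2, 1]), none]],
      ![![none, none], ![none, none], ![none, some (8, [1])], ![some (5, [2, 1]), none]],
      ![![none, none], ![none, none], ![none, some (9, [])], ![none, some (10, [2])]],
      ![![none, none], ![none, none], ![none, some (11, [])], ![none, some (12, [2])]],
      ![![none, none], ![none, none], ![none, some (13, [])], ![some (0, [2, 1, 0]), none]],
      ![![none, none], ![none, none], ![none, none], ![none, none]],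
      ![![none, none], ![none, none], ![none, some (14, [1])], ![some (10, [2, 1]), none]],
      ![![none, none], ![none, none], ![none, some (15, [1])], ![some (12, [2, 1]), none]],
      ![![none, none], ![none, none], ![none, some (16, [])], ![none, some (17, [2])]],
      ![![none, none], ![none, none], ![none, some (18, [])], ![some (2, [2, 1, 0]), none]],
      ![![none, none], ![none, none], ![none, some (19, [])], ![some (9, [2, 1, 0]), none]],
      ![![none, none], ![none, none], ![none, none], ![none, none]],
      ![![none, none], ![none, none], ![none, some (20, [1])], ![some (17, [2, 1]), none]],
      ![![none, none], ![none, none], ![none, some (21, [])], ![some (4, [2, 1, 0]), none]],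
      ![![none, none], ![none, none], ![none, some (22, [])], ![some (11, [2, 1, 0]), none]],
      ![![none, none], ![none, none], ![none, some (23, [])], ![some (16, [2, 1, 0]), none]],
      ![![none, none], ![none, none], ![none, none], ![none, none]],
      ![![none, none], ![none, none], ![some (6, [1, 0]), none], ![some (13, [2, 1, 0]), none]],
      ![![none, none], ![none, none], ![some (7, [1, 0]), none], ![some (18, [2, 1, 0]), none]],
      ![![none, none], ![none, none], ![some (8, [1, 0]), none], ![some (21, [2, 1, 0]), none]],
      ![![none, none], ![none, none], ![some (14, [1, 0]), none], ![some (19, [2, 1, 0]), none]],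
      ![![none, none], ![none, none], ![some (15, [1, 0]), none], ![some (22, [2, 1, 0]), none]],
      ![![none, none], ![none, none], ![some (20, [1, 0]), none], ![some (23, [2, 1, 0]), none]]]) : Fin 28 → Fin 4 → Fin 2 → Option (Fin 24 × List (Fin 3)))
    (by decide +kernel) (by decide +kernel) (by decide +kernel)

end Summit.HodgeConjecture.HodgeConjecture.Theorems

end
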